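import Literature.Probability.RandomPlanarGeometry.HexSAWStripIdentity
import HarnessLib

/-!
# Crux `HexConjecture` (stmt-CriticalPhenomena-0808), line `root-locality-replaces-loewner` (lead c11):
the lower half of the a-priori envelope of the lever's sequence — `triDl L ≥ c/(L+1)` unconditionally

Landing target:
`Summits/CriticalPhenomena/SAWScalingLimit/Theorems/SAWDevelopingMapHexConjectureTriDlLowerBound.lean`
(`--supports stmt-CriticalPhenomena-0808`; registered stub `stub_triDlLowerBound`).

The open registered stubs `stub_triDlLowerRegular` (REG) and `stub_triDlDoubling` of the line are lower-REGULARITY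
statements about the one explicit non-increasing sequence `HV.triDl` (Glazman–Manolescu's triangle tail, half of
Krachun–Panagiotis's `D_{2L+1}`).  Every discussion of them since seat c6 quotes the two-sided a-priori envelope
`c/L ≤ triDl L ≤ C·L^{-ε}`; the upper half is Krachun–Panagiotis's Theorem 3 (`RootLocality.kp_triDl_rpow_decay`, seat c9),
the lower half is Duminil-Copin–Smirnov's `B_T ≥ m/T` combined with `B_{2L+1} ≤ 2cos(π/8)·triDl L` — available in the
tree only since `Literature/…/HexSAWStripIdentity.lean` made `E_T(x_c) = 0` (hence DCS's induction) unconditional.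
This file restates it as the registered stub, fully qualified.
Sources: DuminilCopinSmirnov2012 (§3), GlazmanManolescu2019 (Lemma 4.1, eq. (4.1); Cor. 2.3 of the AIHP version), KrachunPanagiotis2026 (§1, Lemma 2.3).
-/

noncomputable section

namespace Summit.CriticalPhenomena.SAWScalingLimit.Theorems.HexConjecture.RootLocality

/-- **The lower half of the a-priori envelope** (registered stub `stub_triDlLowerBound`): there is `m > 0` with
`m/(L+1) ≤ triDl L` for every `L` — Duminil-Copin–Smirnov's harmonic lower bound for bridges transferred to the triangle
tail through Glazman–Manolescu's `B_{2L+1} ≤ 2cos(π/8)·triDl L`. [cite: KrachunPanagiotis2026, §1 ("the lower bound B_T ≥ c/T") and Lemma 2.3] -/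
theorem stub_triDlLowerBound : ∃ m : ℝ, 0 < m ∧ ∀ L : ℕ, m / ((L : ℝ) + 1) ≤ Literature.Probability.RandomPlanarGeometry.SAW.HV.triDl L :=
  Literature.Probability.RandomPlanarGeometry.SAW.triDl_ge_div

end Summit.CriticalPhenomena.SAWScalingLimit.Theorems.HexConjecture.RootLocality
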